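/-
Origin: expansion seat `planner-pub-hodgecm-pv06-g7-0`, handover #4 v2 (CLAIM 2026-08-18T15:07:22Z; v2 2026-08-18T15:15:44Z supersedes 116c18a1: +4 junction lemmas with pv14-g6 involFlow (hypVel_hypVel, hypVelCLM_mul_self, hypRot_eq_cosh_add_sinh, hypRotEquiv_eq_cosh_add_sinh); HANDOVER #4 2026-08-18T15:26:50Z) md5 fc9a901e75b8e9b03dd4abba67e647f6 (195 l.); additive KERNEL leaf (node N29 / seam S4: differentiable_hermiteFun; hypVelCLM, hypRot_add_flow, hypRotEq (`HOME/pub-hodgecm-pv06-g7/lean/Pv06g7/ArchCHyperbolicFDeriv.lean`, md5 fc9a901e, 195 lines);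
landed by the gen-8 packager in gate run 31 as `HodgeCM/PerL34/ArchCHyperbolicFDeriv.lean` (import ^import Pv06g7\.ArchCHyperbolicFlow[ \t]*$→import HodgeCM.PerL34.ArchCHyperbolicFlow ×1).
-/
/-
Copyright (c) 2026. Released under the Apache-2.0 license.
-/
import Summits.HodgeConjecture.HodgeCM.PerL34.ArchCHyperbolicFlow
import Mathlib.Analysis.SpecialFunctions.ExpDeriv
import Mathlib.Topology.Algebra.Module.FiniteDimension

/-!
# The hyperbolic direction as a Fréchet derivative: junction with the Schwartz-flow generator (node N29, seam S4)

Origin: expansion seat `planner-pub-hodgecm-pv06-g7-0` (unit `pub-hodgecm-pv06-g7`, DAG-node prover #06 gen 7).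
WIP module `Pv06g7.ArchCHyperbolicFDeriv`; intended final place `HodgeCM/PerL34/ArchCHyperbolicFDeriv.lean`.
Imports: this seat's row #3 `Pv06g7.ArchCHyperbolicFlow` (↦ `HodgeCM.PerL34.ArchCHyperbolicFlow`, ONE rewrite) and
Mathlib.  Additive kernel leaf: asserts nothing, complete proofs, nothing cited enters as a hypothesis.

## What is proved (KERNEL)

pv14-g6's Schwartz-flow generator (`HodgeCM.SchwartzWeil.flowGen`, `flowGen_apply : flowGen A Φ x = DΦ(x)(A x)`,
run 31) expresses the 𝒮-topology derivative of a linear composition flow `Φ ↦ Φ ∘ L(s)`, `L(s) = 1 + sA + o(s)`,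
through the FRÉCHET derivative `DΦ(x)(Ax)`.  Row #3 computed the s-derivative of `[p e^{−π|·|²}] ∘ hypRot s`
POINTWISE as `[(hypSymb p) e^{−π|·|²}]`.  This file states the same number in the Fréchet form, so the two meet
by name without either importing the other:

* §1 `differentiable_hermiteFun : Differentiable ℝ (hermiteFun p)` (generic index type; polynomial × Gaussian on
  `ι → ℝ`), with `differentiable_eval_ofReal`, `differentiable_gauss`.
* §2 the velocity as a continuous linear map `hypVelCLM : (ℝ³ × ℝ³) →L[ℝ] (ℝ³ × ℝ³)`, `v ↦ (−y, −x)`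
  (`hypVelCLM_apply`), the vector derivative `hasDerivAt_hypRot_pi : HasDerivAt (s ↦ hypRot s v) (hypVel v) 0`,
  the flow law `hypRot_add_flow : hypRot (s + t) v = hypRot s (hypRot t v)` and the linear automorphisms
  `hypRotEquiv s : (ℝ³ × ℝ³) ≃L[ℝ] (ℝ³ × ℝ³)` (inverse `hypRot (−s)`); junction with pv14-g6's involutive flows
  (`SchwartzHyperbolicFlow.involFlow J hJ s = cosh s • 1 + sinh s • J`, `J * J = 1`, run 31): `hypVelCLM_mul_self :
  J * J = 1` for `J = hypVelCLM` and `hypRotEquiv_eq_cosh_add_sinh : ↑(hypRotEquiv s) = cosh s • 1 + sinh s • J` —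
  so `hypRotEquiv s` IS `involFlow hypVelCLM _ s` (by `ContinuousLinearEquiv.ext`, for whoever imports both).
* §3 **`fderiv_hermiteFun_hypVel : fderiv ℝ (hermiteFun p) v (hypVel v) = hermiteFun (hypSymb p) v`** — i.e.
  with `A = hypVelCLM` and `⇑Φ = hermiteFun p`, pv14-g6's `flowGen A Φ v` IS `[(hypSymb p) e^{−π|·|²}](v)`, and by
  row #2 (`binv_printedHyp`) for `p = binv F` this is `[binv (printedHyp lamF F) e^{−π|·|²}](v)`
  (`fderiv_hermiteFun_binv_hypVel`): the 𝒮-flow generator of the hyperbolic rotation, read through pv05's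
  Bargmann dictionary, is pv12's printed Fock operator of `X₁` at Folland's scaling.

Labels.  KERNEL: everything below.  Not done here (honest, as in rows #2–#3): membership of `hermiteFun p` in
𝒮(ℝ⁶) as a `SchwartzMap` term and the identification of the constructed `ω(exp sX₁)` with `Φ ↦ Φ ∘ hypRot(±s)`.
PerL / QW8 / 2001 texts NOT cited.
-/

set_option autoImplicit false

noncomputable section

namespace HodgeCM
namespace PerL34
namespace Fock
namespace PrintDict

open MvPolynomial Complex
open scoped BigOperators Real
open HodgeCM.PerL34.Fock.Hermite

/-! ## §1  Differentiability of the Hermite-span functions (generic index type) -/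

section Diff

variable {ι : Type*} [Fintype ι]

/-- (Ported verbatim from the HodgeCMPerL package; no docstring in the source.) -/
theorem differentiable_coord_ofReal (k : ι) : Differentiable ℝ (fun x : ι → ℝ => ((x k : ℝ) : ℂ)) :=
  Complex.ofRealCLM.differentiable.comp (differentiable_apply k)

/-- Polynomial functions of the real coordinates are differentiable (induction on the polynomial). -/
theorem differentiable_eval_ofReal (p : MvPolynomial ι ℂ) :
    Differentiable ℝ (fun x : ι → ℝ => eval (fun k => ((x k : ℝ) : ℂ)) p) := by
  induction p using MvPolynomial.induction_on with
  | C a =>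
      simp only [eval_C]
      exact differentiable_const a
  | add p q hp hq =>
      simp only [map_add]
      exact hp.add hq
  | mul_X p k hp =>
      simp only [map_mul, eval_X]
      exact hp.mul (differentiable_coord_ofReal k)

/-- The Gaussian `x ↦ e^{−π Σ x_k²}` is differentiable. -/
theorem differentiable_gauss : Differentiable ℝ (gauss : (ι → ℝ) → ℂ) := by
  unfold gauss
  exact ((Differentiable.fun_sum fun k _ => (differentiable_coord_ofReal k).pow 2).const_mul _).cexp

/-- **`p e^{−π|·|²}` is (Fréchet-)differentiable on `ι → ℝ`** (KERNEL). -/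
theorem differentiable_hermiteFun (p : MvPolynomial ι ℂ) : Differentiable ℝ (hermiteFun p : (ι → ℝ) → ℂ) := by
  have h := (differentiable_eval_ofReal p).mul (differentiable_gauss (ι := ι))
  exact h

end Diff

/-! ## §2  The hyperbolic rotation as a one-parameter group of linear automorphisms of `ℝ³ × ℝ³` -/

/-- The velocity `v = (x, y) ↦ (−y, −x)` as a continuous linear map. -/
def hypVelCLM : (MixedVar → ℝ) →L[ℝ] (MixedVar → ℝ) :=
  LinearMap.toContinuousLinearMap
    { toFun := hypVel
      map_add' := fun v w => by
        funext k
        cases k <;> simp [hypVel] <;> ring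
      map_smul' := fun c v => by
        funext k
        cases k <;> simp [hypVel] }

/-- (Ported verbatim from the HodgeCMPerL package; no docstring in the source.) -/
@[simp] theorem hypVelCLM_apply (v : MixedVar → ℝ) : hypVelCLM v = hypVel v := rfl

/-- The vector-valued derivative of the flow at `s = 0`: `d/ds hypRot s v |₀ = hypVel v`. -/
theorem hasDerivAt_hypRot_pi (v : MixedVar → ℝ) : HasDerivAt (fun s : ℝ => hypRot s v) (hypVel v) 0 :=
  hasDerivAt_pi.2 (hasDerivAt_hypRot_hypVel v)

/-- **Flow law**: `hypRot (s + t) = hypRot s ∘ hypRot t` (addition formulas for `cosh`, `sinh`). -/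
theorem hypRot_add_flow (s t : ℝ) (v : MixedVar → ℝ) : hypRot (s + t) v = hypRot s (hypRot t v) := by
  funext k
  cases k <;> simp only [hypRot, Real.cosh_add, Real.sinh_add] <;> ring

/-- (Ported verbatim from the HodgeCMPerL package; no docstring in the source.) -/
theorem hypRot_neg_hypRot (s : ℝ) (v : MixedVar → ℝ) : hypRot (-s) (hypRot s v) = v := by
  rw [← hypRot_add_flow, neg_add_cancel, hypRot_zero]

/-- (Ported verbatim from the HodgeCMPerL package; no docstring in the source.) -/
theorem hypRot_hypRot_neg (s : ℝ) (v : MixedVar → ℝ) : hypRot s (hypRot (-s) v) = v := by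
  rw [← hypRot_add_flow, add_neg_cancel, hypRot_zero]

/-- The hyperbolic rotation `hypRot s` as a linear automorphism of `ℝ³ × ℝ³`. -/
def hypRotLinearEquiv (s : ℝ) : (MixedVar → ℝ) ≃ₗ[ℝ] (MixedVar → ℝ) :=
  { toFun := hypRot s
    map_add' := hypRot_add s
    map_smul' := fun c v => hypRot_smul s c v
    invFun := hypRot (-s)
    left_inv := hypRot_neg_hypRot s
    right_inv := hypRot_hypRot_neg s }

/-- … and as a continuous linear automorphism (finite dimension). -/
def hypRotEquiv (s : ℝ) : (MixedVar → ℝ) ≃L[ℝ] (MixedVar → ℝ) :=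
  (hypRotLinearEquiv s).toContinuousLinearEquiv

/-- (Ported verbatim from the HodgeCMPerL package; no docstring in the source.) -/
@[simp] theorem hypRotEquiv_apply (s : ℝ) (v : MixedVar → ℝ) : hypRotEquiv s v = hypRot s v := rfl

/-- (Ported verbatim from the HodgeCMPerL package; no docstring in the source.) -/
theorem hypRotEquiv_zero_apply (v : MixedVar → ℝ) : hypRotEquiv 0 v = v := by
  rw [hypRotEquiv_apply, hypRot_zero]

/-! ### Junction with pv14-g6's involutive flows (`SchwartzHyperbolicFlow`: `involFlow J hJ s = cosh s • 1 + sinh s • J`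
for `J * J = 1`): `hypVelCLM` is such a `J`, and `hypRot s` is its flow — stated here in this file's vocabulary only. -/

/-- The velocity field is an involution: `hypVel (hypVel v) = v`. -/
@[simp] theorem hypVel_hypVel (v : MixedVar → ℝ) : hypVel (hypVel v) = v := by
  funext k
  cases k <;> simp [hypVel]

/-- `J * J = 1` for `J = hypVelCLM` (the hypothesis `hJ` of pv14-g6's `involFlow`). -/
theorem hypVelCLM_mul_self : hypVelCLM * hypVelCLM = 1 := by
  ext v k
  simp

/-- `hypRot s = cosh s • 1 + sinh s • J` pointwise (the formula defining pv14-g6's `coshSinhCLM J s`). -/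
theorem hypRot_eq_cosh_add_sinh (s : ℝ) (v : MixedVar → ℝ) :
    hypRot s v = Real.cosh s • v + Real.sinh s • hypVel v := by
  funext k
  cases k <;> simp [hypRot, hypVel] <;> ring

/-- (Ported verbatim from the HodgeCMPerL package; no docstring in the source.) -/
theorem hypRotEquiv_eq_cosh_add_sinh (s : ℝ) :
    (hypRotEquiv s : (MixedVar → ℝ) →L[ℝ] (MixedVar → ℝ))
      = Real.cosh s • (1 : (MixedVar → ℝ) →L[ℝ] (MixedVar → ℝ)) + Real.sinh s • hypVelCLM := by
  ext v k
  simp only [ContinuousLinearEquiv.coe_coe, hypRotEquiv_apply, hypRot_eq_cosh_add_sinh,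
    add_apply, FunLike.coe_smul, Pi.smul_apply, one_apply_eq_self, hypVelCLM_apply]

/-! ## §3  The Fréchet form of the derivative -/

/-- **`D[p e^{−π|·|²}](v)(hypVel v) = [(hypSymb p) e^{−π|·|²}](v)` (KERNEL)**: the Fréchet derivative of a
Hermite-span function in the direction of the hyperbolic velocity field is row #2's symbol `hypSymb` — with
`A = hypVelCLM`, `⇑Φ = hermiteFun p` this is pv14-g6's `flowGen A Φ v` (`flowGen_apply`, by `rfl` there). -/
theorem fderiv_hermiteFun_hypVel (p : MvPolynomial MixedVar ℂ) (v : MixedVar → ℝ) :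
    fderiv ℝ (hermiteFun p) v (hypVel v) = hermiteFun (hypSymb p) v := by
  have h1 : HasDerivAt (fun s : ℝ => hermiteFun p (hypRot s v))
      (fderiv ℝ (hermiteFun p) (hypRot 0 v) (hypVel v)) 0 :=
    ((differentiable_hermiteFun p) _).hasFDerivAt.comp_hasDerivAt (0 : ℝ) (hasDerivAt_hypRot_pi v)
  rw [hypRot_zero] at h1
  exact h1.unique (hasDerivAt_hermiteFun_hypRot p v)

/-- The same with the continuous linear map `hypVelCLM`. -/
theorem fderiv_hermiteFun_hypVelCLM (p : MvPolynomial MixedVar ℂ) (v : MixedVar → ℝ) :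
    fderiv ℝ (hermiteFun p) v (hypVelCLM v) = hermiteFun (hypSymb p) v :=
  fderiv_hermiteFun_hypVel p v

/-- **Through the Bargmann dictionary** (rows #2 + #4): for every Fock polynomial `F ∈ ℂ[z_a, w_a]`,
`D[(B⁻¹F) e^{…}](v)(hypVel v) = [B⁻¹(H F) e^{…}](v)`, `H = printedHyp lamF` pv12's printed operator of `X₁`. -/
theorem fderiv_hermiteFun_binv_hypVel (F : MixedModel) (v : MixedVar → ℝ) :
    fderiv ℝ (hermiteFun (binv F)) v (hypVel v) = hermiteFun (binv (printedHyp lamF F)) v := by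
  rw [fderiv_hermiteFun_hypVel, binv_printedHyp]

end PrintDict
end Fock
end PerL34
end HodgeCM

end
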